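import Summits.PneNP.PneNP.Theorems.ChebyshevTracialDesignThreeWiseTightMatching
import HarnessLib

/-!
# Cell pnp-psdrank, route `ChebyshevTracialDesign`: EXACT NOWHERE-ZERO TIGHT PSD RECTANGLES OF DIMENSION THREE ARE WORTH ONE RECTANGLE
# (crux `TracialDecayExp20`, stmt-PneNP-19878)

Brick 79 (prover g14; MEMO-16 §6(f) 'mixed ranks' + brick 76). Brick 76 settled the junk-free dense cell at `r = 3` for RANK-ONE operators
`X_U = x_U u_U u_Uᵀ`, `Y_M = y_M v_M v_Mᵀ`. Here the rank restriction is removed: for ANY psd contractions `0 ⪯ X_U, Y_M ⪯ I` of `ℝ³` that are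
tight-orthogonal on every tight pair of a `t`-cut (`cc(U,M) = 1 ⇒ X_U Y_M = 0`) and NOWHERE ZERO (`X_U ≠ 0` on the `t`-cuts, `Y_M ≠ 0`), and every
weight `W` supported on the `t`-cuts whose tight-free `[0,1]`-rectangles are bounded by `γ` (`TracialValueLEAt W γ 1`):
    `Σ_U Σ_M W(U,M) tr(X_U Y_M) ≤ γ`            (`exact_dim_three_le`; route currency `exact_dim_three_value_le`: `IsPsdRect`, value/3 ≤ γ/3).
So at `r = 3` the whole difficulty of the dense cell is the ACTIVITY PATTERN (zero operators), for arbitrary ranks and a continuum of ranges.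
* §1 symmetric operators on `ℝ³` via cross products (no spectral theorem): kernel transfer along a parallel range vector; two independent kernel
  vectors ⇒ `X = x u uᵀ` (`exists_rankOne_of_ker_two`); the frame `(p, ℓ, p × ℓ)`; **`trace_mul_eq_of_ker`**: `X p = 0`, `Y ℓ = 0`, `p ⊥ ℓ`
  orthonormal ⇒ `tr(X Y) = ⟨m, X m⟩⟨m, Y m⟩`, `m = p × ℓ`.
* §2 the ABSTRACT SKELETON `exists_factor_of_line_kernel` over index types with a 'tight' relation in which any two columns share a tight row and
  any two rows share a tight column: if one row operator has kernel EXACTLY a line `ℝ p`, then `tr(X_i Y_k) = f_i g_k` with `f, g ∈ [0,1]`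
  ((1) a tight column of that row has range `ℝ p`, sharing it transfers `X_i p = 0` to every row; (2) if all columns have range `ℝ p` all products
  vanish; (3) else a column has a range vector `y₁ ∉ ℝ p`, its tight rows have range `ℝ ℓ₀`, `ℓ₀ = p × y₁`, and sharing them transfers `Y_k ℓ₀ = 0`
  to every column; (4) §1). Used twice: rows = `t`-cuts (common tight cuts, brick 74) and, mirrored, rows = matchings (common tight matchings,
  brick 78 `exists_three_tight_cut`).
* §3 the theorem: line-kernel cut ⇒ §2; line-kernel matching ⇒ §2 mirrored (`trace_mul_comm`); otherwise every operator has two independent kernel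
  vectors (a nonzero tight partner supplies one), hence is `x u uᵀ`, and brick 76 `exact_rankOne_dim_three_le` applies.
[cite: Rothvoss2017, §2 (PDF p. 6: the tight pairs `Q_1`)] [cite: BrietDadushPokutta2014, Thm. 6 (§3): psd factorizations, `tr(A_U B_M) = 0`]
Stature: support/instrument — a TOY CASE (no zero operators = no activity pattern); elementary linear algebra + bricks 74/76/78.
WHAT THIS IS NOT: nothing on the dense cell with junk, nothing on psd rank of P_PM(K_n), no P-vs-NP content.
-/

set_option linter.dupNamespace false -- `Summit.PneNP.PneNP.…`: summit = sub-problem (D-0017)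

noncomputable section

namespace Summit.PneNP.PneNP.Theorems.ChebyshevTracialDesignExactDimThreePsd

open Finset Matrix Literature.Barriers.PneNP Literature.Combinatorics.Optimization
open Literature.Combinatorics.AssociationSchemes.CutMatchingRestriction
open Summit.PneNP.PneNP.Theorems.ChebyshevTracialDesignCommonTightCut
open Summit.PneNP.PneNP.Theorems.ChebyshevTracialDesignExactDimThree
open Summit.PneNP.PneNP.Theorems.ChebyshevTracialDesignThreeWiseTightMatching
open Summit.PneNP.PneNP.Theorems.ChebyshevTracialDesignDimensionOne
open scoped Matrix

/-! ### §1 Symmetric operators on `ℝ³`: kernels, ranges, an orthonormal frame, the trace of a product -/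

section Algebra

variable {X Y : Matrix (Fin 3) (Fin 3) ℝ}

/-- For symmetric `X`: `⟨v, X w⟩ = ⟨X v, w⟩`. -/
theorem dot_mulVec_of_symm (hX : Xᵀ = X) (v w : Fin 3 → ℝ) : v ⬝ᵥ X *ᵥ w = X *ᵥ v ⬝ᵥ w := by
  rw [dotProduct_mulVec, ← mulVec_transpose, hX]

/-- A nonzero matrix moves some vector. -/
theorem exists_mulVec_ne_zero (hX : X ≠ 0) : ∃ z : Fin 3 → ℝ, X *ᵥ z ≠ 0 := by
  by_contra h; push Not at h; exact hX (ext_iff_mulVec.2 fun v => by rw [h v, zero_mulVec])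

/-- A vector orthogonal to `a` and `b` is parallel to `a × b`: `|a × b|² z = ⟨z, a × b⟩ (a × b)`. -/
theorem smul_eq_of_orth_orth {z a b : Fin 3 → ℝ} (ha : z ⬝ᵥ a = 0) (hb : z ⬝ᵥ b = 0) :
    ((a ⨯₃ b) ⬝ᵥ (a ⨯₃ b)) • z = (z ⬝ᵥ (a ⨯₃ b)) • (a ⨯₃ b) :=
  (smul_eq_smul_of_cross_eq_zero (cross_eq_zero_of_orth ha hb)).1

/-- **Transfer of a kernel vector along a parallel range vector.** If `X y = 0` for a vector `y ≠ 0` parallel to `p ≠ 0`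
(`|p|² y = ⟨y,p⟩ p`, so that `⟨y,p⟩ ≠ 0`), then `X p = 0`. -/
theorem mulVec_eq_zero_of_parallel {y p : Fin 3 → ℝ} (hp : p ⬝ᵥ p ≠ 0) (hy : y ≠ 0) (hpar : (p ⬝ᵥ p) • y = (y ⬝ᵥ p) • p)
    (hXy : X *ᵥ y = 0) : X *ᵥ p = 0 := by
  have hc : y ⬝ᵥ p ≠ 0 := fun h0 => by rw [h0, zero_smul, smul_eq_zero] at hpar; exact hpar.elim hp hy
  have h := congrArg (fun v => X *ᵥ v) hpar
  simp only [mulVec_smul, hXy, smul_zero] at h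
  exact (smul_eq_zero.1 h.symm).resolve_left hc

/-- **Range in a line ⇒ rank one.** If `X` is symmetric and every `X z` is parallel to `w` (`|w|² X z = ⟨X z, w⟩ w`), then
`|w|⁴ · X = ⟨w, X w⟩ · w wᵀ`. -/
theorem sq_smul_eq_smul_vecMulVec (hX : Xᵀ = X) {w : Fin 3 → ℝ} (h : ∀ z, (w ⬝ᵥ w) • X *ᵥ z = (X *ᵥ z ⬝ᵥ w) • w) :
    ((w ⬝ᵥ w) ^ 2) • X = (w ⬝ᵥ X *ᵥ w) • vecMulVec w w := by
  refine ext_iff_mulVec.2 fun z => ?_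
  rw [smul_mulVec, smul_mulVec, vecMulVec_mulVec, op_smul_eq_smul, smul_smul, pow_two, ← smul_smul, h z, smul_smul]
  congr 1
  -- `|w|² ⟨X z, w⟩ = ⟨w, X w⟩ ⟨w, z⟩`
  have h1 : X *ᵥ z ⬝ᵥ w = z ⬝ᵥ X *ᵥ w := by rw [dotProduct_comm, dot_mulVec_of_symm hX, dotProduct_comm]
  have h2 := congrArg (fun v => z ⬝ᵥ v) (h w)
  simp only [dotProduct_smul, smul_eq_mul] at h2
  rw [h1, h2, ← dot_mulVec_of_symm hX, dotProduct_comm z w]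

/-- **Two independent kernel vectors ⇒ rank one**: for symmetric `X` with `X a = X b = 0`, `|a × b|⁴ · X = ⟨a × b, X (a × b)⟩ · (a × b)(a × b)ᵀ`. -/
theorem sq_smul_eq_smul_vecMulVec_of_ker (hX : Xᵀ = X) {a b : Fin 3 → ℝ} (ha : X *ᵥ a = 0) (hb : X *ᵥ b = 0) :
    (((a ⨯₃ b) ⬝ᵥ (a ⨯₃ b)) ^ 2) • X = ((a ⨯₃ b) ⬝ᵥ X *ᵥ (a ⨯₃ b)) • vecMulVec (a ⨯₃ b) (a ⨯₃ b) :=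
  sq_smul_eq_smul_vecMulVec hX fun z =>
    smul_eq_of_orth_orth (by rw [← dot_mulVec_of_symm hX, ha, dotProduct_zero]) (by rw [← dot_mulVec_of_symm hX, hb, dotProduct_zero])

/-- **Orthonormal frame.** For orthonormal `p, ℓ` and `m = p × ℓ`: every `z` is `⟨z,p⟩ p + ⟨z,ℓ⟩ ℓ + ⟨z,m⟩ m`, and `|m| = 1`. -/
theorem frame_decomp {p ℓ : Fin 3 → ℝ} (hp : p ⬝ᵥ p = 1) (hl : ℓ ⬝ᵥ ℓ = 1) (hpl : p ⬝ᵥ ℓ = 0) (z : Fin 3 → ℝ) :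
    z = (z ⬝ᵥ p) • p + (z ⬝ᵥ ℓ) • ℓ + (z ⬝ᵥ (p ⨯₃ ℓ)) • (p ⨯₃ ℓ) ∧ (p ⨯₃ ℓ) ⬝ᵥ (p ⨯₃ ℓ) = 1 := by
  have hmm : (p ⨯₃ ℓ) ⬝ᵥ (p ⨯₃ ℓ) = 1 := by rw [cross_dot_cross, hp, hl, hpl, dotProduct_comm ℓ p, hpl]; ring
  refine ⟨?_, hmm⟩
  set z₀ := z - (z ⬝ᵥ p) • p - (z ⬝ᵥ ℓ) • ℓ with hz₀
  have h0p : z₀ ⬝ᵥ p = 0 := by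
    rw [hz₀, sub_dotProduct, sub_dotProduct, smul_dotProduct, smul_dotProduct, hp, dotProduct_comm ℓ p, hpl]; simp
  have h0l : z₀ ⬝ᵥ ℓ = 0 := by
    rw [hz₀, sub_dotProduct, sub_dotProduct, smul_dotProduct, smul_dotProduct, hpl, hl]; simp
  have hpar := smul_eq_of_orth_orth h0p h0l
  rw [hmm, one_smul] at hpar
  have h0m : z₀ ⬝ᵥ (p ⨯₃ ℓ) = z ⬝ᵥ (p ⨯₃ ℓ) := by
    rw [hz₀, sub_dotProduct, sub_dotProduct, smul_dotProduct, smul_dotProduct, dot_self_cross, dot_cross_self]; simp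
  rw [h0m] at hpar
  rw [← hpar, hz₀]; abel

/-- Parseval in the frame `(p, ℓ, p × ℓ)`. -/
theorem dot_eq_frame {p ℓ : Fin 3 → ℝ} (hp : p ⬝ᵥ p = 1) (hl : ℓ ⬝ᵥ ℓ = 1) (hpl : p ⬝ᵥ ℓ = 0) (z z' : Fin 3 → ℝ) :
    z ⬝ᵥ z' = (z ⬝ᵥ p) * (z' ⬝ᵥ p) + (z ⬝ᵥ ℓ) * (z' ⬝ᵥ ℓ) + (z ⬝ᵥ (p ⨯₃ ℓ)) * (z' ⬝ᵥ (p ⨯₃ ℓ)) := by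
  obtain ⟨hz, -⟩ := frame_decomp hp hl hpl z
  conv_lhs => rw [hz]
  simp only [add_dotProduct, smul_dotProduct, smul_eq_mul, dotProduct_comm p z', dotProduct_comm ℓ z', dotProduct_comm (p ⨯₃ ℓ) z']

/-- The trace of a product through the standard basis: `tr(X Y) = Σ_i ⟨X e_i, Y e_i⟩` for symmetric `X`. -/
theorem trace_mul_eq_sum_single (hX : Xᵀ = X) (Y : Matrix (Fin 3) (Fin 3) ℝ) :
    (X * Y).trace = ∑ i, (X *ᵥ Pi.single i 1) ⬝ᵥ (Y *ᵥ Pi.single i 1) := by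
  have hs : ∀ i j, X i j = X j i := fun i j => by rw [← transpose_apply X j i, hX]
  simp only [mulVec_single_one, Matrix.trace, Matrix.diag, Matrix.mul_apply, dotProduct, Matrix.col_apply]
  exact sum_congr rfl fun i _ => sum_congr rfl fun j _ => by rw [hs i j]

/-- **The trace of a product in the frame**: `tr(X Y) = ⟨Xp, Yp⟩ + ⟨Xℓ, Yℓ⟩ + ⟨Xm, Ym⟩` for symmetric `X, Y`. -/
theorem trace_mul_eq_frame (hX : Xᵀ = X) (hY : Yᵀ = Y) {p ℓ : Fin 3 → ℝ} (hp : p ⬝ᵥ p = 1) (hl : ℓ ⬝ᵥ ℓ = 1)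
    (hpl : p ⬝ᵥ ℓ = 0) :
    (X * Y).trace = X *ᵥ p ⬝ᵥ Y *ᵥ p + X *ᵥ ℓ ⬝ᵥ Y *ᵥ ℓ + X *ᵥ (p ⨯₃ ℓ) ⬝ᵥ Y *ᵥ (p ⨯₃ ℓ) := by
  rw [trace_mul_eq_sum_single hX]
  have key : ∀ b : Fin 3 → ℝ, ∑ i : Fin 3, (X *ᵥ Pi.single i 1 ⬝ᵥ b) * (Y *ᵥ Pi.single i 1 ⬝ᵥ b) = X *ᵥ b ⬝ᵥ Y *ᵥ b := by
    intro b
    have e1 : ∀ i : Fin 3, X *ᵥ Pi.single i 1 ⬝ᵥ b = (X *ᵥ b) i := fun i => by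
      rw [← dot_mulVec_of_symm hX, single_one_dotProduct]
    have e2 : ∀ i : Fin 3, Y *ᵥ Pi.single i 1 ⬝ᵥ b = (Y *ᵥ b) i := fun i => by
      rw [← dot_mulVec_of_symm hY, single_one_dotProduct]
    simp only [e1, e2]
    rfl
  rw [sum_congr rfl fun i _ => dot_eq_frame hp hl hpl (X *ᵥ Pi.single i 1) (Y *ᵥ Pi.single i 1), sum_add_distrib,
    sum_add_distrib, key, key, key]

/-- **FACTORISATION.** Symmetric `X, Y` with `X p = 0`, `Y ℓ = 0` for orthonormal `p, ℓ`: `tr(X Y) = ⟨m, X m⟩ ⟨m, Y m⟩`, `m = p × ℓ`. -/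
theorem trace_mul_eq_of_ker (hX : Xᵀ = X) (hY : Yᵀ = Y) {p ℓ : Fin 3 → ℝ} (hp : p ⬝ᵥ p = 1) (hl : ℓ ⬝ᵥ ℓ = 1)
    (hpl : p ⬝ᵥ ℓ = 0) (hXp : X *ᵥ p = 0) (hYl : Y *ᵥ ℓ = 0) :
    (X * Y).trace = ((p ⨯₃ ℓ) ⬝ᵥ X *ᵥ (p ⨯₃ ℓ)) * ((p ⨯₃ ℓ) ⬝ᵥ Y *ᵥ (p ⨯₃ ℓ)) := by
  rw [trace_mul_eq_frame hX hY hp hl hpl, hXp, hYl, zero_dotProduct, dotProduct_zero, zero_add, zero_add,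
    dot_eq_frame hp hl hpl (X *ᵥ (p ⨯₃ ℓ))]
  have h1 : X *ᵥ (p ⨯₃ ℓ) ⬝ᵥ p = 0 := by rw [← dot_mulVec_of_symm hX, hXp, dotProduct_zero]
  have h2 : Y *ᵥ (p ⨯₃ ℓ) ⬝ᵥ ℓ = 0 := by rw [← dot_mulVec_of_symm hY, hYl, dotProduct_zero]
  rw [h1, h2, zero_mul, mul_zero, zero_add, zero_add, ← dot_mulVec_of_symm hX, dotProduct_comm (Y *ᵥ _)]

/-- A psd contraction has diagonal values in `[0,1]` against unit vectors. -/
theorem quad_mem_unitInterval (hX : X.PosSemidef) (hX1 : (1 - X).PosSemidef) {m : Fin 3 → ℝ} (hm : m ⬝ᵥ m = 1) :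
    0 ≤ m ⬝ᵥ X *ᵥ m ∧ m ⬝ᵥ X *ᵥ m ≤ 1 := by
  have h0 := hX.dotProduct_mulVec_nonneg m
  have h1 := hX1.dotProduct_mulVec_nonneg m
  rw [star_trivial] at h0 h1
  rw [sub_mulVec, one_mulVec, dotProduct_sub, hm] at h1
  exact ⟨h0, by linarith⟩

/-- Symmetry of a real psd matrix as `Xᵀ = X`. -/
theorem transpose_eq_of_posSemidef (hX : X.PosSemidef) : Xᵀ = X := by
  rw [← conjTranspose_eq_transpose_of_trivial]; exact hX.1

end Algebra

/-- Normalising a nonzero vector of `ℝ³`: `c = 1/‖v‖` has `‖c v‖ = 1` and `c² = 1/‖v‖²`. -/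
theorem exists_unit_smul {v : Fin 3 → ℝ} (hv : v ≠ 0) : ∃ c : ℝ, (c • v) ⬝ᵥ (c • v) = 1 ∧ c * c = (v ⬝ᵥ v)⁻¹ := by
  have hs0 : 0 < v ⬝ᵥ v :=
    lt_of_le_of_ne (Finset.sum_nonneg fun i _ => mul_self_nonneg (v i)) (fun h => hv (dotProduct_self_eq_zero.1 h.symm))
  have hcc : (Real.sqrt (v ⬝ᵥ v))⁻¹ * (Real.sqrt (v ⬝ᵥ v))⁻¹ = (v ⬝ᵥ v)⁻¹ := by rw [← mul_inv, Real.mul_self_sqrt hs0.le]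
  refine ⟨(Real.sqrt (v ⬝ᵥ v))⁻¹, ?_, hcc⟩
  rw [smul_dotProduct, dotProduct_smul, smul_eq_mul, smul_eq_mul, ← mul_assoc, hcc, inv_mul_cancel₀ hs0.ne']

/-- **Unit rank-one form from two independent kernel vectors.** A psd contraction of `ℝ³` killing `a` and `b` with `a × b ≠ 0` is `x · u uᵀ` with
`‖u‖ = 1`, `0 ≤ x ≤ 1` (`u = (a × b)/‖a × b‖`, `x = ⟨u, X u⟩`). -/
theorem exists_rankOne_of_ker_two {X : Matrix (Fin 3) (Fin 3) ℝ} (hX : X.PosSemidef) (hX1 : (1 - X).PosSemidef)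
    {a b : Fin 3 → ℝ} (ha : X *ᵥ a = 0) (hb : X *ᵥ b = 0) (hab : a ⨯₃ b ≠ 0) :
    ∃ (x : ℝ) (u : Fin 3 → ℝ), u ⬝ᵥ u = 1 ∧ 0 ≤ x ∧ x ≤ 1 ∧ X = x • vecMulVec u u := by
  set w := a ⨯₃ b with hw
  have hs0 : w ⬝ᵥ w ≠ 0 := fun h => hab (dotProduct_self_eq_zero.1 h)
  obtain ⟨c, hu1, hcc⟩ := exists_unit_smul hab
  have key := sq_smul_eq_smul_vecMulVec_of_ker (transpose_eq_of_posSemidef hX) ha hb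
  rw [← hw] at key
  refine ⟨(c • w) ⬝ᵥ X *ᵥ (c • w), c • w, hu1, (quad_mem_unitInterval hX hX1 hu1).1, (quad_mem_unitInterval hX hX1 hu1).2, ?_⟩
  have hx : (c • w) ⬝ᵥ X *ᵥ (c • w) = (w ⬝ᵥ w)⁻¹ * (w ⬝ᵥ X *ᵥ w) := by
    rw [smul_dotProduct, mulVec_smul, dotProduct_smul, smul_eq_mul, smul_eq_mul, ← mul_assoc, hcc]
  have huu : vecMulVec (c • w) (c • w) = (w ⬝ᵥ w)⁻¹ • vecMulVec w w := by rw [smul_vecMulVec, vecMulVec_smul, smul_smul, hcc]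
  rw [hx, huu, smul_smul, mul_assoc, mul_comm (w ⬝ᵥ X *ᵥ w), ← mul_assoc, ← smul_smul, ← key, smul_smul, pow_two,
    show (w ⬝ᵥ w)⁻¹ * (w ⬝ᵥ w)⁻¹ * ((w ⬝ᵥ w) * (w ⬝ᵥ w)) = 1 by field_simp, one_smul]

/-! ### §2 The abstract skeleton: one-rectangle factorisation from a line kernel -/

section Skeleton

variable {ι κ : Type*} {P : ι → Prop} {Q : κ → Prop} {T : ι → κ → Prop}
  {X : ι → Matrix (Fin 3) (Fin 3) ℝ} {Y : κ → Matrix (Fin 3) (Fin 3) ℝ}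

/-- **Factorisation from two kernels.** Psd contractions `X_i` (relevant: `P i`) all killing `p ≠ 0` and `Y_k` (relevant: `Q k`) all killing `ℓ ≠ 0`
with `p ⊥ ℓ`: there are `f : ι → [0,1]`, `g : κ → [0,1]` with `tr(X_i Y_k) = f_i g_k` on relevant pairs (`f = ⟨m, X m⟩`, `g = ⟨m, Y m⟩`, `m` the unit
normal of `p, ℓ`). [cite: BrietDadushPokutta2014, Thm. 6 (§3)] -/
theorem exists_factor_of_kernels (hX : ∀ i, P i → (X i).PosSemidef ∧ (1 - X i).PosSemidef)
    (hY : ∀ k, Q k → (Y k).PosSemidef ∧ (1 - Y k).PosSemidef) {p ℓ : Fin 3 → ℝ} (hp : p ≠ 0) (hl : ℓ ≠ 0) (hpl : p ⬝ᵥ ℓ = 0)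
    (hXp : ∀ i, P i → X i *ᵥ p = 0) (hYl : ∀ k, Q k → Y k *ᵥ ℓ = 0) :
    ∃ (f : ι → ℝ) (g : κ → ℝ), (∀ i, 0 ≤ f i ∧ f i ≤ 1) ∧ (∀ k, 0 ≤ g k ∧ g k ≤ 1) ∧
      ∀ i k, P i → Q k → (X i * Y k).trace = f i * g k := by
  classical
  obtain ⟨c, hc, -⟩ := exists_unit_smul hp
  obtain ⟨d, hd, -⟩ := exists_unit_smul hl
  have hpl' : (c • p) ⬝ᵥ (d • ℓ) = 0 := by rw [smul_dotProduct, dotProduct_smul, hpl, smul_zero, smul_zero]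
  set m := (c • p) ⨯₃ (d • ℓ) with hm
  have hm1 : m ⬝ᵥ m = 1 := (frame_decomp hc hd hpl' 0).2
  refine ⟨fun i => if P i then m ⬝ᵥ X i *ᵥ m else 0, fun k => if Q k then m ⬝ᵥ Y k *ᵥ m else 0, fun i => ?_, fun k => ?_,
    fun i k hi hk => ?_⟩
  · dsimp only
    by_cases hi : P i
    · rw [if_pos hi]; exact quad_mem_unitInterval (hX i hi).1 (hX i hi).2 hm1
    · rw [if_neg hi]; exact ⟨le_rfl, zero_le_one⟩
  · dsimp only
    by_cases hk : Q k
    · rw [if_pos hk]; exact quad_mem_unitInterval (hY k hk).1 (hY k hk).2 hm1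
    · rw [if_neg hk]; exact ⟨le_rfl, zero_le_one⟩
  · dsimp only
    rw [if_pos hi, if_pos hk, hm]
    exact trace_mul_eq_of_ker (transpose_eq_of_posSemidef (hX i hi).1) (transpose_eq_of_posSemidef (hY k hk).1) hc hd hpl'
      (by rw [mulVec_smul, hXp i hi, smul_zero]) (by rw [mulVec_smul, hYl k hk, smul_zero])

/-- **ONE-RECTANGLE FACTORISATION FROM A LINE KERNEL (abstract skeleton of MEMO-16 §6(f)).** Index types `ι` ('cuts') and `κ` ('matchings') with
relevance predicates `P`, `Q` and a 'tight' relation `T`; psd contractions `X_i`, `Y_k` of `ℝ³` with `X_i Y_k = 0` on relevant tight pairs, all relevant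
operators NONZERO; any two relevant columns share a relevant tight row and any two relevant rows share a relevant tight column. If some relevant `X_{i₀}`
has kernel EXACTLY a line `ℝ p`, then `tr(X_i Y_k) = f_i g_k` on relevant pairs for some `f, g` with values in `[0,1]`. Steps: (1) a relevant tight
column `k` of `i₀` has range in `ℝ p`, and sharing it transfers `X_i p = 0` to every relevant row; (2) if every relevant column has range `ℝ p` all
relevant products vanish (`f = g = 0`); (3) otherwise some column has a range vector `y₁ ∉ ℝ p`, the rows tight with it have range in `ℝ ℓ₀`,
`ℓ₀ = p × y₁`, and sharing such a row transfers `Y_k ℓ₀ = 0` to every relevant column; (4) `exists_factor_of_kernels`.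
[cite: BrietDadushPokutta2014, Thm. 6 (§3)] -/
theorem exists_factor_of_line_kernel (hX : ∀ i, P i → (X i).PosSemidef ∧ (1 - X i).PosSemidef)
    (hY : ∀ k, Q k → (Y k).PosSemidef ∧ (1 - Y k).PosSemidef) (h0 : ∀ i k, P i → Q k → T i k → X i * Y k = 0)
    (hX0 : ∀ i, P i → X i ≠ 0) (hY0 : ∀ k, Q k → Y k ≠ 0) (hrow : ∀ k k', Q k → Q k' → ∃ i, P i ∧ T i k ∧ T i k')
    (hcol : ∀ i i', P i → P i' → ∃ k, Q k ∧ T i k ∧ T i' k) {i₀ : ι} (hi₀ : P i₀) {p : Fin 3 → ℝ} (hp : p ≠ 0)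
    (hker : ∀ v, X i₀ *ᵥ v = 0 → v ⨯₃ p = 0) :
    ∃ (f : ι → ℝ) (g : κ → ℝ), (∀ i, 0 ≤ f i ∧ f i ≤ 1) ∧ (∀ k, 0 ≤ g k ∧ g k ≤ 1) ∧
      ∀ i k, P i → Q k → (X i * Y k).trace = f i * g k := by
  have hXt : ∀ i, P i → (X i)ᵀ = X i := fun i hi => transpose_eq_of_posSemidef (hX i hi).1
  have hYt : ∀ k, Q k → (Y k)ᵀ = Y k := fun k hk => transpose_eq_of_posSemidef (hY k hk).1
  have h0' : ∀ i k, P i → Q k → T i k → Y k * X i = 0 := fun i k hi hk hik => by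
    simpa only [transpose_mul, transpose_zero, hXt i hi, hYt k hk] using congrArg transpose (h0 i k hi hk hik)
  have hpp : p ⬝ᵥ p ≠ 0 := fun h => hp (dotProduct_self_eq_zero.1 h)
  -- (1) every relevant row kills `p`
  have hXp : ∀ i, P i → X i *ᵥ p = 0 := by
    intro i hi
    obtain ⟨k, hk, hik, hi₀k⟩ := hcol i i₀ hi hi₀
    obtain ⟨z, hz⟩ := exists_mulVec_ne_zero (hY0 k hk)
    have hkz : X i₀ *ᵥ (Y k *ᵥ z) = 0 := by rw [mulVec_mulVec, h0 i₀ k hi₀ hk hi₀k, zero_mulVec]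
    have hiz : X i *ᵥ (Y k *ᵥ z) = 0 := by rw [mulVec_mulVec, h0 i k hi hk hik, zero_mulVec]
    exact mulVec_eq_zero_of_parallel hpp hz (smul_eq_smul_of_cross_eq_zero (hker _ hkz)).1 hiz
  by_cases hA1 : ∀ k, Q k → ∀ z, (Y k *ᵥ z) ⨯₃ p = 0
  · -- (2) every relevant column has range `ℝ p`: all relevant products vanish
    refine ⟨fun _ => 0, fun _ => 0, fun _ => ⟨le_rfl, zero_le_one⟩, fun _ => ⟨le_rfl, zero_le_one⟩, fun i k hi hk => ?_⟩
    have hXY : X i * Y k = 0 := by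
      refine ext_iff_mulVec.2 fun z => ?_
      rw [← mulVec_mulVec, zero_mulVec]
      have h := congrArg (fun v => X i *ᵥ v) (smul_eq_smul_of_cross_eq_zero (hA1 k hk z)).1
      simp only [mulVec_smul, hXp i hi, smul_zero] at h
      exact (smul_eq_zero.1 h).resolve_left hpp
    rw [hXY, trace_zero, zero_mul]
  · -- (3) a column with a range vector off `ℝ p`; `ℓ₀ = p × y₁`
    push Not at hA1
    obtain ⟨k₁, hk₁, z₁, hy₁⟩ := hA1
    have hℓ0 : p ⨯₃ (Y k₁ *ᵥ z₁) ≠ 0 := by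
      intro h; apply hy₁; rw [← cross_anticomm, h, neg_zero]
    have hll : (p ⨯₃ (Y k₁ *ᵥ z₁)) ⬝ᵥ (p ⨯₃ (Y k₁ *ᵥ z₁)) ≠ 0 := fun h => hℓ0 (dotProduct_self_eq_zero.1 h)
    have hYl : ∀ k, Q k → Y k *ᵥ (p ⨯₃ (Y k₁ *ᵥ z₁)) = 0 := by
      intro k hk
      obtain ⟨i, hi, hik, hik₁⟩ := hrow k k₁ hk hk₁
      obtain ⟨z, hz⟩ := exists_mulVec_ne_zero (hX0 i hi)
      have h1 : X i *ᵥ z ⬝ᵥ p = 0 := by rw [← dot_mulVec_of_symm (hXt i hi), hXp i hi, dotProduct_zero]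
      have h2 : X i *ᵥ z ⬝ᵥ (Y k₁ *ᵥ z₁) = 0 := by
        rw [← dot_mulVec_of_symm (hXt i hi), mulVec_mulVec, h0 i k₁ hi hk₁ hik₁, zero_mulVec, dotProduct_zero]
      have hkz : Y k *ᵥ (X i *ᵥ z) = 0 := by rw [mulVec_mulVec, h0' i k hi hk hik, zero_mulVec]
      exact mulVec_eq_zero_of_parallel hll hz (smul_eq_of_orth_orth h1 h2) hkz
    -- (4)
    exact exists_factor_of_kernels hX hY hp hℓ0 (dot_self_cross p _) hXp hYl

end Skeleton

/-! ### §3 The theorem: exact nowhere-zero tight psd rectangles of dimension three -/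

section Exact

variable {n : ℕ}

/-- **EXACT NOWHERE-ZERO TIGHT PSD RECTANGLES IN `ℝ³` ARE WORTH ONE TIGHT RECTANGLE.** `n` even, `t` odd, `t + 1 ≤ n`; psd contractions
`X_U, Y_M` of `ℝ³` (`0 ⪯ X_U, Y_M ⪯ I`), tight-orthogonal on EVERY tight pair of a `t`-cut (`|U| = t`, `cc(U,M) = 1 ⇒ X_U Y_M = 0`) and NOWHERE ZERO
(`X_U ≠ 0` on the `t`-cuts, `Y_M ≠ 0`) — any ranks; `W` supported on the `t`-cuts with `TracialValueLEAt W γ 1`. Then `Σ_U Σ_M W(U,M) tr(X_U Y_M) ≤ γ`.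
Proof: every operator has a kernel vector (a nonzero tight partner); if some `X_{U₀}` (resp. `Y_{M₀}`) has kernel exactly a line, the skeleton
`exists_factor_of_line_kernel` (rows = `t`-cuts, columns = matchings, resp. mirrored; common tight cuts by brick 74, common tight matchings by
brick 78) factorises `tr(X_U Y_M) = f_U g_M` through `[0,1]`-weights, a tight-free weighted rectangle (`sum_box_le_rectangle`); otherwise every
operator has two independent kernel vectors, hence is `x · u uᵀ` (`exists_rankOne_of_ker_two`), and brick 76 applies.
[cite: Rothvoss2017, §2 (PDF p. 6)] [cite: BrietDadushPokutta2014, Thm. 6 (§3)] -/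
theorem exact_dim_three_le {t : ℕ} (hn : Even n) (ht : Odd t) (htn : t + 1 ≤ n)
    (W : OddSet n → PMatch n → ℝ) (γ : ℝ) (hγ : TracialValueLEAt W γ 1) (hWt : ∀ U M, U.1.card ≠ t → W U M = 0)
    (X : OddSet n → Matrix (Fin 3) (Fin 3) ℝ) (Y : PMatch n → Matrix (Fin 3) (Fin 3) ℝ)
    (hX : ∀ U, (X U).PosSemidef ∧ (1 - X U).PosSemidef) (hY : ∀ M, (Y M).PosSemidef ∧ (1 - Y M).PosSemidef)
    (htight : ∀ U M, U.1.card = t → cc U M = 1 → X U * Y M = 0) (hX0 : ∀ U, U.1.card = t → X U ≠ 0) (hY0 : ∀ M, Y M ≠ 0) :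
    ∑ U, ∑ M, W U M * (X U * Y M).trace ≤ γ := by
  classical
  have hrect := (tracialValueLEAt_one_iff W γ).1 hγ
  have hXt : ∀ U, (X U)ᵀ = X U := fun U => transpose_eq_of_posSemidef (hX U).1
  have hYt : ∀ M, (Y M)ᵀ = Y M := fun M => transpose_eq_of_posSemidef (hY M).1
  have htight' : ∀ U M, U.1.card = t → cc U M = 1 → Y M * X U = 0 := fun U M hU h => by
    simpa only [transpose_mul, transpose_zero, hXt, hYt] using congrArg transpose (htight U M hU h)
  -- combinatorial supplies: common tight `t`-cuts (brick 74), common tight matchings (brick 78)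
  have hrow : ∀ M M' : PMatch n, True → True → ∃ U : OddSet n, U.1.card = t ∧ cc U M = 1 ∧ cc U M' = 1 :=
    fun M M' _ _ => exists_common_tight_cut ht htn M M'
  have hcol : ∀ U U' : OddSet n, U.1.card = t → U'.1.card = t → ∃ M : PMatch n, True ∧ cc U M = 1 ∧ cc U' M = 1 :=
    fun U U' _ _ => by obtain ⟨M, h1, h2, -⟩ := exists_three_tight_cut hn U U' U'; exact ⟨M, trivial, h1, h2⟩
  -- a factorisation through `[0,1]`-weights on the `t`-cuts bounds the value by one tight-free rectangle
  have hfac : ∀ (f : OddSet n → ℝ) (g : PMatch n → ℝ), (∀ U, 0 ≤ f U ∧ f U ≤ 1) → (∀ M, 0 ≤ g M ∧ g M ≤ 1) →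
      (∀ U M, U.1.card = t → (X U * Y M).trace = f U * g M) → ∑ U, ∑ M, W U M * (X U * Y M).trace ≤ γ := by
    intro f g hf hg hfg
    set f' : OddSet n → ℝ := fun U => if U.1.card = t then f U else 0 with hf'
    have hf'b : ∀ U, 0 ≤ f' U ∧ f' U ≤ 1 := fun U => by
      by_cases hU : U.1.card = t <;> simp only [hf', hU, if_true, if_false, le_refl, zero_le_one, and_self, hf U]
    have heq : ∑ U, ∑ M, W U M * (X U * Y M).trace = ∑ U, ∑ M, W U M * (f' U * g M) := by
      refine sum_congr rfl fun U _ => sum_congr rfl fun M _ => ?_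
      by_cases hU : U.1.card = t
      · rw [hfg U M hU]; simp only [hf', hU, if_true]
      · rw [hWt U M hU, zero_mul, zero_mul]
    rw [heq]
    obtain ⟨A, B, hAB, hle⟩ := sum_box_le_rectangle W (fun U M => cc U M = 1) f' g hf'b hg (fun U M hUM => by
      by_cases hU : U.1.card = t
      · simp only [hf', hU, if_true]; rw [← hfg U M hU, htight U M hU hUM, trace_zero]
      · simp only [hf', hU, if_false, zero_mul])
    exact hle.trans (hrect A B hAB)
  -- CASE A: some `t`-cut operator has kernel exactly a line
  by_cases hA : ∃ U₀ : OddSet n, U₀.1.card = t ∧ ∃ p : Fin 3 → ℝ, p ≠ 0 ∧ ∀ v, X U₀ *ᵥ v = 0 → v ⨯₃ p = 0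
  · obtain ⟨U₀, hU₀, p, hp, hker⟩ := hA
    obtain ⟨f, g, hf, hg, hfg⟩ := exists_factor_of_line_kernel (P := fun U : OddSet n => U.1.card = t) (Q := fun _ : PMatch n => True)
      (T := fun U M => cc U M = 1) (fun U _ => hX U) (fun M _ => hY M) (fun U M hU _ h => htight U M hU h) hX0 (fun M _ => hY0 M)
      hrow hcol hU₀ hp hker
    exact hfac f g hf hg fun U M hU => hfg U M hU trivial
  -- CASE B: some matching operator has kernel exactly a line (mirror: rows = matchings, columns = `t`-cuts)
  by_cases hB : ∃ M₀ : PMatch n, ∃ q : Fin 3 → ℝ, q ≠ 0 ∧ ∀ v, Y M₀ *ᵥ v = 0 → v ⨯₃ q = 0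
  · obtain ⟨M₀, q, hq, hker⟩ := hB
    obtain ⟨g, f, hg, hf, hgf⟩ := exists_factor_of_line_kernel (P := fun _ : PMatch n => True) (Q := fun U : OddSet n => U.1.card = t)
      (T := fun M U => cc U M = 1) (X := Y) (Y := X) (fun M _ => hY M) (fun U _ => hX U) (fun M U _ hU h => htight' U M hU h)
      (fun M _ => hY0 M) hX0 (fun U U' hU hU' => hcol U U' hU hU') (fun M M' _ _ => hrow M M' trivial trivial) (i₀ := M₀) trivial hq hker
    refine hfac f g hf hg fun U M hU => ?_
    rw [← trace_mul_comm, hgf M U trivial hU, mul_comm]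
  -- CASE C: every operator has two independent kernel vectors, hence is rank one — brick 76
  push Not at hA hB
  have hXr : ∀ U : OddSet n, ∃ (x : ℝ) (u : Fin 3 → ℝ), u ⬝ᵥ u = 1 ∧ 0 ≤ x ∧ x ≤ 1 ∧ (U.1.card ≠ t → x = 0) ∧
      (U.1.card = t → X U = x • vecMulVec u u) := by
    intro U
    by_cases hU : U.1.card = t
    · -- a nonzero kernel vector from a nonzero tight partner
      obtain ⟨M, hUM, -, -⟩ := exists_three_tight_cut hn U U U
      obtain ⟨z, hz⟩ := exists_mulVec_ne_zero (hY0 M)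
      have hk : X U *ᵥ (Y M *ᵥ z) = 0 := by rw [mulVec_mulVec, htight U M hU hUM, zero_mulVec]
      obtain ⟨v, hv, hvk⟩ := hA U hU (Y M *ᵥ z) hz
      obtain ⟨x, u, hu, hx0, hx1, hXe⟩ := exists_rankOne_of_ker_two (hX U).1 (hX U).2 hv hk hvk
      exact ⟨x, u, hu, hx0, hx1, fun h => absurd hU h, fun _ => hXe⟩
    · exact ⟨0, Pi.single 0 1, by simp, le_rfl, zero_le_one, fun _ => rfl, fun h => absurd h hU⟩
  have hYr : ∀ M : PMatch n, ∃ (y : ℝ) (v : Fin 3 → ℝ), v ⬝ᵥ v = 1 ∧ 0 ≤ y ∧ y ≤ 1 ∧ Y M = y • vecMulVec v v := by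
    intro M
    obtain ⟨U, hU, hUM⟩ := exists_tight_cut ht htn M
    obtain ⟨z, hz⟩ := exists_mulVec_ne_zero (hX0 U hU)
    have hk : Y M *ᵥ (X U *ᵥ z) = 0 := by rw [mulVec_mulVec, htight' U M hU hUM, zero_mulVec]
    obtain ⟨v, hv, hvk⟩ := hB M (X U *ᵥ z) hz
    exact exists_rankOne_of_ker_two (hY M).1 (hY M).2 hv hk hvk
  choose x u hu hx0 hx1 hxt hXe using hXr
  choose y v hv hy0 hy1 hYe using hYr
  -- exact orthogonality of the labels on the tight pairs of `t`-cuts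
  have horth : ∀ U M, U.1.card = t → cc U M = 1 → u U ⬝ᵥ v M = 0 := by
    intro U M hU hUM
    have h0 : (X U * Y M).trace = 0 := by rw [htight U M hU hUM, trace_zero]
    rw [hXe U hU, hYe M, trace_rankOne_mul_rankOne] at h0
    have hxU : x U ≠ 0 := fun h => hX0 U hU (by rw [hXe U hU, h, zero_smul])
    have hyM : y M ≠ 0 := fun h => hY0 M (by rw [hYe M, h, zero_smul])
    exact pow_eq_zero_iff two_ne_zero |>.1 ((mul_eq_zero.1 h0).resolve_left (mul_ne_zero hxU hyM))
  have heq : ∑ U, ∑ M, W U M * (X U * Y M).trace = ∑ U, ∑ M, W U M * (x U * y M * (u U ⬝ᵥ v M) ^ 2) := by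
    refine sum_congr rfl fun U _ => sum_congr rfl fun M _ => ?_
    by_cases hU : U.1.card = t
    · rw [hXe U hU, hYe M, trace_rankOne_mul_rankOne]
    · rw [hWt U M hU, zero_mul, zero_mul]
  rw [heq]
  exact exact_rankOne_dim_three_le hn ht htn W γ hγ x y (fun U => ⟨hx0 U, hx1 U⟩) (fun M => ⟨hy0 M, hy1 M⟩) hxt u v hu hv horth

/-- **Corollary in the route's currency.** A tight-orthogonal psd rectangle `(X, Y)` of dimension `3` (`IsPsdRect X Y`) with NO ZERO OPERATOR
(`X_U ≠ 0` on the `t`-cuts, `Y_M ≠ 0`) has normalised value `(1/3) Σ W tr(X_U Y_M) ≤ γ/3` against every `W` supported on the `t`-cuts with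
`TracialValueLEAt W γ 1`; in particular against the design weights `levelWeight n t C w`. The whole difficulty of the dense cell at `r = 3` is
therefore the ACTIVITY PATTERN (where operators vanish). [cite: Rothvoss2017, §2 (PDF p. 6)] [cite: BrietDadushPokutta2014, Thm. 6 (§3)] -/
theorem exact_dim_three_value_le {t : ℕ} (hn : Even n) (ht : Odd t) (htn : t + 1 ≤ n)
    (W : OddSet n → PMatch n → ℝ) (γ : ℝ) (hγ : TracialValueLEAt W γ 1) (hWt : ∀ U M, U.1.card ≠ t → W U M = 0)
    {X : OddSet n → Matrix (Fin 3) (Fin 3) ℝ} {Y : PMatch n → Matrix (Fin 3) (Fin 3) ℝ} (hXY : IsPsdRect X Y)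
    (hX0 : ∀ U, U.1.card = t → X U ≠ 0) (hY0 : ∀ M, Y M ≠ 0) :
    (∑ U, ∑ M, W U M * (X U * Y M).trace) / 3 ≤ γ / 3 := by
  have h := exact_dim_three_le hn ht htn W γ hγ hWt X Y hXY.1 hXY.2.1 (fun U M _ h => hXY.2.2 U M h) hX0 hY0
  linarith

end Exact

end Summit.PneNP.PneNP.Theorems.ChebyshevTracialDesignExactDimThreePsd
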